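import HarnessLib
import Summits.RiemannHypothesis.RiemannHypothesis.Theorems.SignConePointwiseCheckerSound

/-!
# Route SignCone: pointwise certificate `pwCert1` — data and scalar checks

Support for the unconditional rungs of `SignConeOscillatory` / `SignConeInequality`
(items stmt-RiemannHypothesis-16302 / 16301). The rational data `pwCert1 : PWData` of a pointwise
certificate (kernel `E_χ`, slack, fake weights, slope constant; format and soundness in
`SignConePointwiseCheckerSound.lean`) and the kernel evaluation of its scalar checks
(`pwCert1_checkScalars`, frequency cut-off `Y₀ = 70`). The grid cells are checked in the sibling files
`SignConePointwiseCertOneGrids*.lean` and assembled in `SignConePointwiseCertOne.lean`. The data were produced by a floating-point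
design LP plus an emulation of the checker (work files of the prover seat); nothing about them is
trusted — only the kernel-evaluated Booleans are used.
-/

-- `Summit.RiemannHypothesis.RiemannHypothesis.…` repeats a namespace component by design (D-0017 layout).
set_option linter.dupNamespace false

noncomputable section

namespace Summit.RiemannHypothesis.RiemannHypothesis.Theorems.SignCone

open Literature.Analysis.ValidatedNumerics.Numerics

/-- The pointwise certificate `pwCert1` (`b = 1`: plateau `L = 2`, knot spacing
`h = 3/8`, `7` interior knot values; slack `1`; fake weights on the nodes
`2, 3, 4, 5, 7`; slope constant and engine parameters). Proof data for the rung; see the module docstring. [folklore] -/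
def pwCert1 : PWData where
  d := ⟨2, 3/8, [(-9373/50000), 17617/50000, 883/12500, 1077/100000, 443/4000, (-3817/100000), 1019/25000]⟩
  s := 1
  nodeList := [2, 3, 4, 5, 7]
  a := fun n => if n = 2 then 32813/100000 else if n = 3 then 349/4000 else if n = 4 then 115307/100000 else if n = 5 then 78051/100000 else if n = 7 then 96611/100000 else 0
  slope := 18325699/500000
  prec := 64
  mw := 40
  mws := 4
  mwT := 2000
  logN := 7

set_option maxHeartbeats 0 in
/-- **Kernel check of the scalar conditions** (data sanity, knots, slope constant, tail beyond `Y₀ = 70`). [folklore] -/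
theorem pwCert1_checkScalars : pwCert1.checkScalars 70 = true := by
  decide +kernel

end Summit.RiemannHypothesis.RiemannHypothesis.Theorems.SignCone

end
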